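import Literature.MathematicalPhysics.QuantumLattice.SectorGroundState
import Literature.MathematicalPhysics.QuantumLattice.ContractionResidualBound
import HarnessLib

/-!
# Symmetry-reduced bootstrap certificates with a residual (tracial sector ground state)

Family `hubbard` (topic `MathematicalPhysics/QuantumLattice`). Companion to
`Matrix.minEnergyOn_ge_of_symmetric_certificate` (SectorGroundState): the feasible point there is
the normalised tracial state `ω_P` of the sector ground projection `P` (invariant under every
symmetry `U` commuting with `A` and preserving the sector), and a ROUNDED certificate carries an
exactly known residual `Σₖ aₖ Mₖ` in contractions `Mₖ` (fermionic / Pauli monomials). Since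
`tr(P M) = Σⱼ ⟨bⱼ, M bⱼ⟩` over an orthonormal frame of the ground multiplet
(`exists_frame_trace_projMatrix_map_mul`), `Re (a · ω_P(M)) ≥ −‖a‖` for a contraction `M`
(`Matrix.sectorGroundProj_re_mul_projState_ge`), whence the residual version
`Matrix.minEnergyOn_ge_of_symmetric_certificate_residual`: `c − Σₖ ‖aₖ‖ ≤ minEnergyOn A K`.
This is the shape of a translation/point-group REDUCED certificate on a finite torus
(certificate format `certsdp/1`, `hypotheses.averaging` / `reduce`, bundle
papers/HubbardSuperconductivity/manybody-bootstrap/): monomials are identified with their images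
under lattice symmetries through the null terms `U Y Uᴴ − Y`. Everything is PROVED; no definition,
no named fact.

## References
* X. Han, *Quantum many-body bootstrap*, arXiv:2006.06002 (2020), §2 eq. (2)–(3) (symmetry
  constraints `⟨U⁻¹ O U⟩ = ⟨O⟩`). [cite: Han2020Bootstrap, §2 eq. (2)–(3)]
* I. Kull, N. Schuch, B. Dive, M. Navascués, PRX 14 (2024) 021008, §5.3 (rounded certificates).
  [cite: KullEtAl2024, §5.3]
* H. Tasaki, *Physics and Mathematics of Quantum Many-Body Systems* (2020), §2.1–2.2, App. A.2.
  [cite: Tasaki2020, §2.2]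
-/

noncomputable section

open Literature.MathematicalPhysics.QuantumLattice
open Literature.MathematicalPhysics.QuantumManyBody.StateRelaxation
open scoped ComplexOrder BigOperators

namespace Matrix

variable {n : Type*} [Fintype n] [DecidableEq n]

/-- **Contractions in the tracial sector ground state**: for Hermitian `A`, an `A`-invariant sector
`K ≠ ⊥`, a contraction `M` (`1 − Mᴴ M ⪰ 0`) and any `a ∈ ℂ`,
`−‖a‖ ≤ Re (a · ω_P(M))`, `ω_P = tr(P ·)/tr P`, `P` the sector ground projection
(expand `tr(P M)` over an orthonormal frame of the ground multiplet and use `|⟨b, M b⟩| ≤ 1`).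
[folklore] -/
theorem sectorGroundProj_re_mul_projState_ge {A : Matrix n n ℂ} (hA : A.IsHermitian)
    (K : Submodule ℂ (n → ℂ)) (hKA : ∀ v ∈ K, A *ᵥ v ∈ K) (hK : K ≠ ⊥)
    {M : Matrix n n ℂ} (hM : M.IsContraction) (a : ℂ) :
    -‖a‖ ≤ (a * (A.sectorGroundProj K).projState M).re := by
  obtain ⟨k, b, hk, -, hb1, htr⟩ := exists_frame_trace_projMatrix_map_mul (A.sectorGroundSpace K)
  have hS : A.sectorGroundSpace K ≠ ⊥ := inf_eigenspace_minEnergyOn_ne_bot hA K hKA hK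
  have hkpos : 0 < k := by
    rw [hk]
    exact Nat.pos_of_ne_zero fun h0 => hS (Submodule.finrank_eq_zero.mp h0)
  have htrP : (A.sectorGroundProj K).trace = (k : ℂ) := by
    rw [sectorGroundProj, trace_projMatrix_map_eq_finrank, ← hk]
  have htrM : (A.sectorGroundProj K * M).trace = ∑ j, star (b j) ⬝ᵥ M *ᵥ b j := htr M
  rw [projState_apply, htrP, htrM]
  have hterm : ∀ j, -‖a‖ ≤ (a * (star (b j) ⬝ᵥ M *ᵥ b j)).re := fun j => by
    have h := hM.neg_norm_mul_le a (b j)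
    rwa [hb1 j, Complex.one_re, mul_one] at h
  set S : ℂ := ∑ j, star (b j) ⬝ᵥ M *ᵥ b j with hSdef
  have hsum : -(‖a‖ * k) ≤ (a * S).re := by
    rw [hSdef, Finset.mul_sum, Complex.re_sum]
    have h := Finset.sum_le_sum fun j (_ : j ∈ (Finset.univ : Finset (Fin k))) => hterm j
    simp only [Finset.sum_const, Finset.card_univ, Fintype.card_fin, nsmul_eq_mul] at h
    linarith
  have hkR : (0 : ℝ) < k := by exact_mod_cast hkpos
  have hre : (a * ((k : ℂ)⁻¹ * S)).re = (k : ℝ)⁻¹ * (a * S).re := by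
    have e : a * ((k : ℂ)⁻¹ * S) = (((k : ℝ)⁻¹ : ℝ) : ℂ) * (a * S) := by push_cast; ring
    rw [e, Complex.re_ofReal_mul]
  rw [hre]
  calc -‖a‖ = (k : ℝ)⁻¹ * (-(‖a‖ * k)) := by field_simp
    _ ≤ (k : ℝ)⁻¹ * (a * S).re := mul_le_mul_of_nonneg_left hsum (inv_nonneg.mpr hkR.le)

/-- **Symmetry- and charge-reduced certificate with a residual ⇒ sector ground energy.** As in
`Matrix.minEnergyOn_ge_of_symmetric_certificate` (Hermitian `A`, `A`-invariant sector `K ≠ ⊥`,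
`Λ ⪰ 0`, commutator null terms, symmetry defects `Uₗ Yₗ Uₗᴴ − Yₗ` for symmetries `Uₗ` commuting with
`A` with `Uₗ, Uₗᴴ` preserving `K` and `Uₗᴴ Uₗ = 1`, charge terms `Zᵢ (Qᵢ − qᵢ) + (Qᵢ − qᵢ) Z'ᵢ` for
Hermitian `Qᵢ` acting as the real scalar `qᵢ` on `K`), plus an explicit residual `Σₖ aₖ Mₖ` in
contractions `Mₖ`: the identity
`A − c·1 = Σᵢⱼ Λᵢⱼ Oᵢᴴ Oⱼ + (Σ[A,Xₖ] + Σ(Uₗ Yₗ Uₗᴴ − Yₗ) + Σ(Zᵢ (Qᵢ − qᵢ) + (Qᵢ − qᵢ) Z'ᵢ)) + Σₖ aₖ Mₖ`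
proves `c − Σₖ ‖aₖ‖ ≤ minEnergyOn A K`. Han 2020 §2 eq. (2)–(3) with KSDN 2024 §5.3 rounding.
[cite: Han2020Bootstrap, §2 eq. (2)–(3)] -/
theorem minEnergyOn_ge_of_symmetric_certificate_residual {A : Matrix n n ℂ} (hA : A.IsHermitian)
    (K : Submodule ℂ (n → ℂ)) (hKA : ∀ v ∈ K, A *ᵥ v ∈ K) (hK : K ≠ ⊥)
    {m : Type*} [Fintype m] [DecidableEq m] {Λ : Matrix m m ℂ} (hΛ : Λ.PosSemidef)
    (O : m → Matrix n n ℂ)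
    {κ : Type*} (s : Finset κ) (X : κ → Matrix n n ℂ)
    {ι : Type*} (t : Finset ι) (U Y : ι → Matrix n n ℂ) (hU : ∀ l ∈ t, U l * A = A * U l)
    (hUK : ∀ l ∈ t, ∀ v ∈ K, U l *ᵥ v ∈ K) (hUK' : ∀ l ∈ t, ∀ v ∈ K, (U l)ᴴ *ᵥ v ∈ K)
    (hUU : ∀ l ∈ t, (U l)ᴴ * U l = 1)
    {ρ : Type*} (r : Finset ρ) (Q Z Z' : ρ → Matrix n n ℂ) (q : ρ → ℝ)
    (hQh : ∀ i ∈ r, (Q i).IsHermitian) (hQ : ∀ i ∈ r, ∀ v ∈ K, Q i *ᵥ v = ((q i : ℝ) : ℂ) • v)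
    {κ'' : Type*} (w : Finset κ'') (a : κ'' → ℂ) (M : κ'' → Matrix n n ℂ)
    (hM : ∀ k ∈ w, (M k).IsContraction) {c : ℝ}
    (hcert : A - (c : ℂ) • (1 : Matrix n n ℂ) =
      gramForm Λ O + (∑ k ∈ s, (A * X k - X k * A) + ∑ l ∈ t, (U l * Y l * (U l)ᴴ - Y l) +
        ∑ i ∈ r, (Z i * (Q i - ((q i : ℝ) : ℂ) • 1) + (Q i - ((q i : ℝ) : ℂ) • 1) * Z' i)) +
        ∑ k ∈ w, a k • M k) :
    c - ∑ k ∈ w, ‖a k‖ ≤ A.minEnergyOn K := by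
  set P := A.sectorGroundProj K with hP
  set e : ℂ := ((A.minEnergyOn K : ℝ) : ℂ) with he
  have hPh : P.IsHermitian := sectorGroundProj_isHermitian A K
  have hP2 : P * P = P := sectorGroundProj_mul_self A K
  have hP0 : P ≠ 0 := sectorGroundProj_ne_zero hA K hKA hK
  have hAP : A * P = e • P := mul_sectorGroundProj A K
  have hPA : P * A = e • P := sectorGroundProj_mul hA K
  set ω := P.projState with hω
  have hpos : ∀ x : Matrix n n ℂ, 0 ≤ ω (star x * x) := fun x => by
    rw [hω, star_eq_conjTranspose]; exact projState_nonneg hPh hP2 x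
  have hone : ω 1 = 1 := projState_one hPh hP2 hP0
  have hnull : ω (∑ k ∈ s, (A * X k - X k * A) + ∑ l ∈ t, (U l * Y l * (U l)ᴴ - Y l) +
      ∑ i ∈ r, (Z i * (Q i - ((q i : ℝ) : ℂ) • 1) + (Q i - ((q i : ℝ) : ℂ) • 1) * Z' i)) = 0 := by
    rw [map_add, map_add, map_sum, map_sum, map_sum]
    have h1 : ∀ k ∈ s, ω (A * X k - X k * A) = 0 := fun k _ => projState_commutator hAP hPA _
    have h2 : ∀ l ∈ t, ω (U l * Y l * (U l)ᴴ - Y l) = 0 := fun l hl => by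
      rw [map_sub, hω, projState_conj (sectorGroundProj_commute hA K (hU l hl) (hUK l hl) (hUK' l hl))
        (hUU l hl), sub_self]
    have h3 : ∀ i ∈ r, ω (Z i * (Q i - ((q i : ℝ) : ℂ) • 1) + (Q i - ((q i : ℝ) : ℂ) • 1) * Z' i) = 0 :=
      fun i hi => by
        rw [map_add, hω, projState_mul_of_mul_eq_zero (sub_smul_mul_sectorGroundProj A K (hQ i hi)),
          projState_mul_of_mul_eq_zero' (sectorGroundProj_mul_sub_smul A K (hQh i hi) (hQ i hi)),
          add_zero]
    rw [Finset.sum_eq_zero h1, Finset.sum_eq_zero h2, Finset.sum_eq_zero h3, add_zero, add_zero]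
  have hr : -(∑ k ∈ w, ‖a k‖) ≤ (ω (∑ k ∈ w, a k • M k)).re :=
    neg_sum_norm_le_re_map_sum w ω a M fun k hk => by
      rw [hω]; exact sectorGroundProj_re_mul_projState_ge hA K hKA hK (hM k hk) (a k)
  have h := le_re_map_of_certificate_residual ω hpos hone hΛ O hnull hr hcert
  rwa [hω, projState_self hPh hP2 hP0 hPA, he, Complex.ofReal_re] at h

end Matrix
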